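import Summits.AtomisticToContinuum.Statement
import Mathlib

/-!
# AtomisticToContinuum / BECInfraredBound — assemblies

Route `AtomisticToContinuum/BECInfraredBound`. Thesis X_B1 (stmt-AtomisticToContinuum-0686):
macroscopic occupation of the normalised constant mode `φ₀ = L^{-3/2}·1_{Λ_L}` by every
near-minimiser of the Dirichlet `N`-body energy in the box of side `L = (N/ρ)^{1/3}`.
This file settles the glue item of the route:
* `stmt-AtomisticToContinuum-0687`: X_B1 → `BoseEinsteinCondensation`, since
  `⟨φ₀, γ_Ψ φ₀⟩ ≤ λ_max(γ_Ψ)` (`occupation_le_maxOccupation`, `φ₀` measurable and `L²`-normalised)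
  uniformly over `δ`-near-minimisers bounds `condensateNumber` from below (`le_condensateNumber`);
* `stmt-AtomisticToContinuum-0688` (shared summit assembly) needs no new declaration: it is
  `Literature.StatMech.atomisticToContinuum_of_conjuncts`
  (`Crystallization/Theorems/CrystalLocalRigidityAssembly.lean`, stmt-0624; not imported here —
  this file only needs `import Mathlib` for the measure-theoretic glue).
-/

noncomputable section

namespace AtomisticToContinuum.BECInfraredBound

open MeasureTheory ENNReal Filter Literature.MathematicalPhysics.QuantumManyBody.BoseGas WithLp

/-- The open box `Λ_L = (0,L)³ ⊂ ℝ³` is measurable (finite intersection of coordinate slabs).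
[folklore] -/
theorem measurableSet_box (L : ℝ) : MeasurableSet (Literature.MathematicalPhysics.QuantumManyBody.BoseGas.box L) := by
  have : Literature.MathematicalPhysics.QuantumManyBody.BoseGas.box L = ⋂ k : Fin 3, (fun x : Literature.MathematicalPhysics.QuantumManyBody.BoseGas.Space => x k) ⁻¹' Set.Ioo 0 L := by
    ext x; simp [Literature.MathematicalPhysics.QuantumManyBody.BoseGas.box]
  rw [this]
  exact MeasurableSet.iInter fun k => measurableSet_Ioo.preimage (by fun_prop)

/-- `|Λ_L| = L³` (Lebesgue measure on `EuclideanSpace ℝ (Fin 3)` is the product measure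
transported by `WithLp.ofLp`; `ENNReal.ofReal L ^ 3`, which is the junk value `0` for `L ≤ 0`,
where the box is empty). [folklore] -/
theorem volume_box (L : ℝ) : volume (Literature.MathematicalPhysics.QuantumManyBody.BoseGas.box L) = ENNReal.ofReal L ^ 3 := by
  have h : Literature.MathematicalPhysics.QuantumManyBody.BoseGas.box L = (@ofLp 2 (Fin 3 → ℝ)) ⁻¹' (Set.univ.pi fun _ => Set.Ioo 0 L) := by
    ext x; simp [Literature.MathematicalPhysics.QuantumManyBody.BoseGas.box]
  rw [h, (PiLp.volume_preserving_ofLp (Fin 3)).measure_preimage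
    (MeasurableSet.univ_pi fun _ => measurableSet_Ioo).nullMeasurableSet, volume_pi_pi]
  simp

/-- The constant mode `φ₀ = L^{-3/2}·1_{Λ_L}` is `L²`-normalised for `L > 0`:
`∫ |φ₀|² = L⁻³ · |Λ_L| = 1`. [folklore] -/
theorem lintegral_constMode_sq {L : ℝ} (hL : 0 < L) :
    ∫⁻ x, (‖(Literature.MathematicalPhysics.QuantumManyBody.BoseGas.box L).indicator (fun _ => ((Real.sqrt (L ^ 3))⁻¹ : ℂ)) x‖₊ : ℝ≥0∞) ^ 2
      = 1 := by
  have hL3 : 0 ≤ L ^ 3 := by positivity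
  have h1 : (fun x => (‖(Literature.MathematicalPhysics.QuantumManyBody.BoseGas.box L).indicator (fun _ => ((Real.sqrt (L ^ 3))⁻¹ : ℂ)) x‖₊ :
      ℝ≥0∞) ^ 2) = (Literature.MathematicalPhysics.QuantumManyBody.BoseGas.box L).indicator (fun _ => ENNReal.ofReal ((L ^ 3)⁻¹)) := by
    funext x
    by_cases hx : x ∈ Literature.MathematicalPhysics.QuantumManyBody.BoseGas.box L
    · simp only [Set.indicator_of_mem hx]
      rw [← ENNReal.coe_pow, ENNReal.ofReal, ENNReal.coe_inj]
      ext
      rw [NNReal.coe_pow, coe_nnnorm, norm_inv, Complex.norm_real,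
        Real.norm_of_nonneg (Real.sqrt_nonneg _), inv_pow, Real.sq_sqrt hL3,
        Real.coe_toNNReal _ (by positivity)]
    · simp [hx]
  rw [h1, lintegral_indicator (measurableSet_box L), setLIntegral_const, volume_box,
    ← ENNReal.ofReal_pow hL.le, ← ENNReal.ofReal_mul (by positivity),
    inv_mul_cancel₀ (by positivity), ENNReal.ofReal_one]

/-- The constant mode is a.e.-strongly measurable (indicator of a measurable set). [folklore] -/
theorem aestronglyMeasurable_constMode (L : ℝ) :
    AEStronglyMeasurable
      ((Literature.MathematicalPhysics.QuantumManyBody.BoseGas.box L).indicator (fun _ => ((Real.sqrt (L ^ 3))⁻¹ : ℂ))) volume :=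
  (aestronglyMeasurable_const.indicator (measurableSet_box L))

/-- Settles `stmt-AtomisticToContinuum-0687` (exact signature): X_B1 (zero-mode macroscopic
occupation, uniform over `δ`-near-minimisers) → `BoseEinsteinCondensation`, via
`occupation_le_maxOccupation` (for the measurable, normalised constant mode, `L = (N/ρ)^{1/3} > 0`
for `N > 0`) and `le_condensateNumber` (Lieb–Seiringer–Solovej–Yngvason 2005, §1.2 (1.17)–(1.19)).
[folklore] -/
theorem bec_of_zeroMode :
    (∀ v : ℝ → ℝ≥0∞, Literature.MathematicalPhysics.QuantumManyBody.BoseGas.IsRepulsiveFiniteRange v → ∃ ρ₀ : ℝ, 0 < ρ₀ ∧ ∀ ρ : ℝ, 0 < ρ → ρ < ρ₀ → ∃ c : ℝ, 0 < c ∧ ∀ᶠ N : ℕ in Filter.atTop, ∃ δ : ℝ≥0∞, 0 < δ ∧ ∀ Ψ : Literature.MathematicalPhysics.QuantumManyBody.BoseGas.TrialState N (Literature.MathematicalPhysics.QuantumManyBody.BoseGas.sideLength ρ N), Literature.MathematicalPhysics.QuantumManyBody.BoseGas.energy v Ψ ≤ Literature.MathematicalPhysics.QuantumManyBody.BoseGas.groundStateEnergy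 v N (Literature.MathematicalPhysics.QuantumManyBody.BoseGas.sideLength ρ N) + δ → ENNReal.ofReal (c * N) ≤ Literature.MathematicalPhysics.QuantumManyBody.BoseGas.occupation N ((Literature.MathematicalPhysics.QuantumManyBody.BoseGas.box (Literature.MathematicalPhysics.QuantumManyBody.BoseGas.sideLength ρ N)).indicator fun _ => ((Real.sqrt (Literature.MathematicalPhysics.QuantumManyBody.BoseGas.sideLength ρ N ^ 3))⁻¹ : ℂ)) Ψ.ψ) → Literature.MathematicalPhysics.QuantumManyBody.BoseGas.BoseEinsteinCondensation := by
  intro h v hv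
  obtain ⟨ρ₀, hρ₀, H⟩ := h v hv
  refine ⟨ρ₀, hρ₀, fun ρ hρ hρlt => ?_⟩
  obtain ⟨c, hc, hev⟩ := H ρ hρ hρlt
  refine ⟨c, hc, ?_⟩
  filter_upwards [hev, eventually_gt_atTop 0] with N hN hNpos
  obtain ⟨δ, hδ, hΨ⟩ := hN
  have hL : 0 < Literature.MathematicalPhysics.QuantumManyBody.BoseGas.sideLength ρ N := by
    unfold Literature.MathematicalPhysics.QuantumManyBody.BoseGas.sideLength
    exact Real.rpow_pos_of_pos (div_pos (Nat.cast_pos.mpr hNpos) hρ) _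
  exact le_condensateNumber v hδ fun Ψ hE =>
    (hΨ Ψ hE).trans (occupation_le_maxOccupation _ (aestronglyMeasurable_constMode _)
      (lintegral_constMode_sq hL))

end AtomisticToContinuum.BECInfraredBound

end
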